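import Summits.QuantumFields.YangMills.Theorems.BalabanUVNodesN15TwoGridEntry3Full
import Summits.QuantumFields.YangMills.Theorems.BalabanUVNodesN15OperatorReadout
import Literature.MathematicalPhysics.QuantumFieldTheory.Balaban1983to89.T4EtaRateDefectSite
import HarnessLib

/-!
# Route «BalabanUVNodes», node N15 = NE2, -a lane, part 55: THE NODE-VOCABULARY READOUT OF BAŁABAN's FULL LANDAU-GAUGE PAIR `(G′, G)` AT `U ≡ 1` —
# `T4EtaRate.NE2ZeroOperator` ∕ the node's first conjunct `NE2PlusOperator` BY NAME, entries 0 and 3 PROVED (parts 52∕54), MODULO ENTRIES 1–2 (displayed binders)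

Cell `pub-ymgap`, seat `pub-ymgap-dag-n15-a` (KNIT-BY-NAME, g12); `--supports stmt-QuantumFields-20290 --as helper`.  Imports BY NAME part 54 (`hasMaj_twoGridDefect_lap`), part 52
(`hasMaj_twoGridDefect`), n15-b's `…N15.OperatorReadout` (`opGeo`, `opFamily`, `etaRateIneq342_of_hasMaj`, `rateFactor_opGeo`) and the one-point background carrier `pt9Bg`; nothing
in the tree is modified.  PATTERN = part 17 (`…N15VectorPieceReadout.ne2ZeroOperator_vec_of_entry3`: the vector single-scale piece read out MODULO its fourth entry) with the roles
swapped: here ENTRIES 0 AND 3 of (3.42) for the pair `(G′, G) = (Δ′_a⁻¹, Δ_a⁻¹)` ARE THEOREMS and ENTRIES 1–2 (`𝔇(∇G)`, `𝔇(G∇*)`) are the CONSUMER's operators `T1 i`, `T2 i`.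
WHAT.  (§62) the index `TGIndex` of the torus family of record (`m_T`, `k ≥ 1`, `m`; `M = MP (paramsOf d L m_T k hL)`), the realised geometries `tgGeoC` ∕ `tgGeoF` (`opGeo` over
`unitTorusGeo L k M` ∕ `unitTorusGeo L (k+m) M`, arguments = real 1-forms blocked by King's unit blocks), the η-pairing `tgPairing` (scale shift `m`, identity on sites, King's pull-back
of test 1-forms), the paired instances `tgInstance`, the four entry operators `tgOps a T1 T2 = ![idef P P G′ G, T1, T2, idef P P (ρ′(sLap′)∘G′) (ρ(sLap)∘G)]` and their kernel families
`tgFamily`.  (§63) `etaRateIneq342_tg` (one index: four block majorants `B·(L^k)^{−γ₀}·e^{−δ₀|y−y′|_T}` ⇒ `EtaRateIneq342` — prefactors `1`, max-rate-factor `(L^k)^{−γ₀}`);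
★★ **`ne2ZeroOperator_fullG_of_entries12`**: for odd `L ≥ 3`, `a > 0`: IF `T1 i`, `T2 i` have UNIFORM majorants `B₁·(L^k)^{−γ₁}·e^{−δ₁|y−y′|_T}` (`γ₁, δ₁ > 0`), THEN
`NE2ZeroOperator (tgInstance hL) (tgFamily hL a T1 T2)` — entries 0 and 3 from parts 52∕54 at `γ = ½` (rate exponent `min(¼, γ₁)`, decay `min(min δ₀ δ₃, δ₁)`); and
`ne2PlusOperator_fullG_of_entries12` (the node's FIRST CONJUNCT by name at the one-point carrier — the «+» block is inert there, the content is NE2⁰'s, said).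
HONEST FRAMING ∕ LIMITS.  A READOUT, not an estimate: entries 1–2 are DISPLAYED BINDERS (a vacuous `T1 = T2 = 0` satisfies them — the caveat of part 17 for `T3`); their located input is
(1.112) with ε-Hölder sources (plan §7.3), NOT in the tree's block-majorant currency.  `U ≡ 1` torus family of record; one-point background carrier; the [B9] size parameter `M` of
the realised geometries is INERT (`= 1`); Hölder ∕ L² ∕ global sorts of the kernel family inert (`opFamily`); `Δ` of entry 3 = the componentwise lattice Laplacian `ρ(sLap)`
(= [B9]'s `Δ_U` only AT `U ≡ 1`); count-neutral (typed 28∕28 · discharged 5∕27 of record unchanged); NOT a discharge of N15 (object-bound; NE2⁺ NOT PRINTED); one finite T⁴ at fixed ε —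
NOT infinite volume, NOT OS on ℝ⁴, NOT a mass gap, NOT Clay.
-/

noncomputable section

open scoped BigOperators
open Finset

namespace Summit.QuantumFields.YangMills.BalabanUVNodes.N15.TwoGrid

open Literature.MathematicalPhysics.QuantumFieldTheory.Balaban1983to89
open Literature.MathematicalPhysics.QuantumFieldTheory.Balaban1983to89.B11SectG (BlockNorm HasMaj)
open Literature.MathematicalPhysics.QuantumFieldTheory.Balaban1983to89.T4EtaRate (PairedInstance EtaPairing EtaRateIneq342 NE2PlusOperator NE2ZeroOperator)
open Literature.MathematicalPhysics.QuantumFieldTheory.Balaban1983to89.T4EtaRateDefect (idef)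
open Literature.MathematicalPhysics.QuantumFieldTheory.Balaban1983to89.T4EtaRateDefectSite (pt9Bg)
open Literature.MathematicalPhysics.QuantumFieldTheory.Balaban1983to89.T4EtaRateCoeffDefect (pull pull_apply)
open Literature.MathematicalPhysics.QuantumFieldTheory.Balaban1983to89.B5Prop11Plancherel (Tor fine)
open Literature.MathematicalPhysics.QuantumFieldTheory.Balaban1983to89.B5SiteBridgeP12 (MP)
open Literature.MathematicalPhysics.QuantumFieldTheory.Balaban1983to89.B6UnitTorusCarrier (unitTorusGeo unitTorusGeo_len)
open Literature.MathematicalPhysics.QuantumFieldTheory.King1986.Torus (blockOf tdistT tdistT_nonneg)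
open Summit.QuantumFields.YangMills.BalabanUVNodes.N15.OperatorReadout (opGeo opFamily opGeo_len rateFactor_opGeo etaRateIneq342_of_hasMaj)
open Summit.QuantumFields.YangMills.BalabanUVNodes.N15.VectorPiece (blkFine blkFine_comp_kingPrV kingPrV)

variable {d : ℕ}

/-! ## §62 The realised paired-instance family of the torus family of record -/

/-- THE INDEX of the torus family of record: torus exponent `m_T` (periods `M_μ = 2L^{m_T}` through `paramsOf`), the coarse run's number of scales `k ≥ 1` (`η = L^{−k}`), and
the scale shift `m` (`η′ = L^{−m}η`). [folklore] -/
structure TGIndex where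
  /-- the torus exponent -/
  mT : ℕ
  /-- number of scales of the coarse run -/
  k : ℕ
  /-- `k ≥ 1` -/
  one_le : 1 ≤ k
  /-- scale shift to the fine run -/
  m : ℕ

/-- The index type is inhabited. [folklore] -/
theorem tgIndex_nonempty : Nonempty TGIndex := ⟨⟨0, 1, le_rfl, 0⟩⟩

variable {L : ℕ} [NeZero L]

/-- The period vector of the torus of record at an index (`M = MP (paramsOf d L m_T k hL)`). [folklore] -/
abbrev TGIndex.Mn (d : ℕ) (hL : Odd L ∧ 1 < L) (i : TGIndex) : Fin (d + 1) → ℕ := MP (paramsOf d L i.mT i.k hL)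

/-- THE COARSE REALISED GEOMETRY at an index: n15-b's `opGeo` over the one-scale [B6] carrier `unitTorusGeo L k M` (sites = the unit torus, King's `tdistT`, `η = L^{−k}`, every site
of physical size `1`), arguments = real 1-forms at level `k` blocked by the unit block of their base point. [cite: Balaban1985BackgroundPropagators, (3.42) p.397 (typing template)] -/
@[reducible] def tgGeoC (d : ℕ) (hL : Odd L ∧ 1 < L) (i : TGIndex) : B9.Geometry :=
  opGeo (unitTorusGeo L i.k (TGIndex.Mn d hL i)) (Tor (fine (L ^ i.k) (TGIndex.Mn d hL i)) × Fin (d + 1)) (blkFine L i.k (TGIndex.Mn d hL i))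

/-- THE FINE REALISED GEOMETRY at an index: the same over `unitTorusGeo L (k + m) M` with the level-`k + m` real 1-forms, blocked by the unit block of their base point.
[cite: Balaban1985BackgroundPropagators, (3.42) p.397 (typing template)] -/
@[reducible] def tgGeoF (d : ℕ) (hL : Odd L ∧ 1 < L) (i : TGIndex) : B9.Geometry :=
  opGeo (unitTorusGeo L (i.k + i.m) (TGIndex.Mn d hL i)) (Tor (fine (L ^ i.m * L ^ i.k) (TGIndex.Mn d hL i)) × Fin (d + 1))
    (fun j : Tor (fine (L ^ i.m * L ^ i.k) (TGIndex.Mn d hL i)) × Fin (d + 1) => blockOf (L ^ i.m * L ^ i.k) (TGIndex.Mn d hL i) j.1)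

/-- THE η-PAIRING of the two realised geometries (NOT PRINTED data, `T4EtaRate.EtaPairing`): scale shift `m`, identity on sites, King's pull-back of test 1-forms along the bond
pairing (`τλ = λ ∘ prV`: supports and sup norms preserved), one-point backgrounds — the shape of part 17's `vecPairing`. [cite: King1986, p.664 (convention before Prop. 3.8)] -/
def tgPairing (d : ℕ) (hL : Odd L ∧ 1 < L) (i : TGIndex) : EtaPairing (tgGeoC d hL i) (tgGeoF d hL i) pt9Bg pt9Bg where
  n := i.m
  k_eq := rfl
  L_eq := rfl
  M_eq := rfl
  eta_eq := by
    have hL0 : (L : ℝ) ≠ 0 := Nat.cast_ne_zero.mpr (NeZero.ne L)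
    show (((L : ℝ) ^ (i.k + i.m)))⁻¹ * (L : ℝ) ^ i.m = (((L : ℝ) ^ i.k))⁻¹
    rw [pow_add, mul_inv, mul_assoc, inv_mul_cancel₀ (pow_ne_zero _ hL0), mul_one]
  ι := fun y => y
  scale_ι := fun _ => rfl
  dist_ι := fun _ _ => rfl
  τ := fun lam => pull (kingPrV L i.k i.m (TGIndex.Mn d hL i)) lam
  suppIn_τ := fun lam y h x' hx' => by
    have hb := congrFun (blkFine_comp_kingPrV (TGIndex.Mn d hL i) L i.k i.m) x'
    simp only [Function.comp] at hb
    exact h _ (by rw [hb]; exact hx')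
  supNorm_τ := fun lam => by
    show (⨆ x' : Tor (fine (L ^ i.m * L ^ i.k) (TGIndex.Mn d hL i)) × Fin (d + 1), |lam (kingPrV L i.k i.m (TGIndex.Mn d hL i) x')|)
      ≤ ⨆ x : Tor (fine (L ^ i.k) (TGIndex.Mn d hL i)) × Fin (d + 1), |lam x|
    exact ciSup_le fun x' => le_ciSup (Finite.bddAbove_range fun x => |lam x|) (kingPrV L i.k i.m (TGIndex.Mn d hL i) x')
  avg := fun U => U
  avg_one := rfl

/-- THE REALISED PAIRED-INSTANCE FAMILY of the torus family of record (coarse∕fine realised geometries, one-point backgrounds, the pairing above).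
[cite: Balaban1985BackgroundPropagators, Thm 3.14 pp.426–427 (typing template)] -/
def tgInstance (d : ℕ) (hL : Odd L ∧ 1 < L) (i : TGIndex) : PairedInstance :=
  ⟨tgGeoC d hL i, tgGeoF d hL i, pt9Bg, pt9Bg, tgPairing d hL i⟩

/-- THE FOUR ENTRY OPERATORS at an index for Bałaban's pair `(G′, G) = (gOp M (L^m·L^k) a, gOp M (L^k) a)`: ENTRY 0 `idef P P G′ G = G′P − PG` and ENTRY 3 `idef P P (Δ′∘G′) (Δ∘G)`
(`Δ = ρ(sLap)`) are the pair's; ENTRIES 1–2 (`𝔇(∇G)`, `𝔇(G∇*)`) are SUPPLIED BY THE CONSUMER (`T1`, `T2`) — their estimates are the located open input of this chain.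
[cite: Balaban1985BackgroundPropagators, (3.42) p.397 (the four entries)] -/
def tgOps (d : ℕ) (hL : Odd L ∧ 1 < L) (a : ℝ)
    (T1 T2 : ∀ i : TGIndex, (Tor (fine (L ^ i.k) (TGIndex.Mn d hL i)) × Fin (d + 1) → ℝ) →ₗ[ℝ] (Tor (fine (L ^ i.m * L ^ i.k) (TGIndex.Mn d hL i)) × Fin (d + 1) → ℝ))
    (i : TGIndex) :
    Fin 4 → Unit → ((Tor (fine (L ^ i.k) (TGIndex.Mn d hL i)) × Fin (d + 1) → ℝ) →ₗ[ℝ] (Tor (fine (L ^ i.m * L ^ i.k) (TGIndex.Mn d hL i)) × Fin (d + 1) → ℝ)) :=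
  fun n _ => ![idef (pull (kingPrV L i.k i.m (TGIndex.Mn d hL i))) (pull (kingPrV L i.k i.m (TGIndex.Mn d hL i)))
      (gOp (TGIndex.Mn d hL i) (L ^ i.m * L ^ i.k) a) (gOp (TGIndex.Mn d hL i) (L ^ i.k) a),
    T1 i, T2 i,
    idef (pull (kingPrV L i.k i.m (TGIndex.Mn d hL i))) (pull (kingPrV L i.k i.m (TGIndex.Mn d hL i)))
      (symbOp (TGIndex.Mn d hL i) (L ^ i.m * L ^ i.k) (sLap (TGIndex.Mn d hL i) (L ^ i.m * L ^ i.k) ((L ^ i.m * L ^ i.k : ℕ) : ℝ)) ∘ₗ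
        gOp (TGIndex.Mn d hL i) (L ^ i.m * L ^ i.k) a)
      (symbOp (TGIndex.Mn d hL i) (L ^ i.k) (sLap (TGIndex.Mn d hL i) (L ^ i.k) ((L ^ i.k : ℕ) : ℝ)) ∘ₗ gOp (TGIndex.Mn d hL i) (L ^ i.k) a)] n

/-- THE KERNEL FAMILIES of the realised instances: n15-b's `opFamily` (entry `e n U λ y` = sup over the fine cube `y` of `|T_n λ|`). [cite: Balaban1985BackgroundPropagators, (3.42) p.397 (the four sup entries: shape)] -/
def tgFamily (d : ℕ) (hL : Odd L ∧ 1 < L) (a : ℝ)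
    (T1 T2 : ∀ i : TGIndex, (Tor (fine (L ^ i.k) (TGIndex.Mn d hL i)) × Fin (d + 1) → ℝ) →ₗ[ℝ] (Tor (fine (L ^ i.m * L ^ i.k) (TGIndex.Mn d hL i)) × Fin (d + 1) → ℝ))
    (i : TGIndex) : B9.KernelFamily (tgInstance d hL i).gc (tgInstance d hL i).Bf :=
  show B9.KernelFamily (tgGeoC d hL i) pt9Bg from
    opFamily (g := unitTorusGeo L i.k (TGIndex.Mn d hL i)) (blkFine L i.k (TGIndex.Mn d hL i))
      (fun j : Tor (fine (L ^ i.m * L ^ i.k) (TGIndex.Mn d hL i)) × Fin (d + 1) => blockOf (L ^ i.m * L ^ i.k) (TGIndex.Mn d hL i) j.1) (tgOps d hL a T1 T2 i)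

/-! ## §63 The readout: `EtaRateIneq342` at one index; `NE2ZeroOperator` ∕ `NE2PlusOperator` BY NAME modulo entries 1–2 -/

/-- **THE READOUT, ONE INDEX, ONE CONFIGURATION.**  If the four entry operators have block majorants `B·(L^k)^{−γ₀}·e^{−δ₀|y−y′|_T}` on the unit-torus carrier, then the realised kernel
family satisfies `T4EtaRate.EtaRateIneq342` with `(B, δ₀, γ₀)` — the (3.42) prefactors are all `1` (every site has physical size `L^kη = 1`) and the max-rate-factor is `(L^k)^{−γ₀}`.
[cite: Balaban1985BackgroundPropagators, Thm 3.1 (3.42) p.397 (shape)] -/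
theorem etaRateIneq342_tg (hL : Odd L ∧ 1 < L) (a : ℝ)
    (T1 T2 : ∀ i : TGIndex, (Tor (fine (L ^ i.k) (TGIndex.Mn d hL i)) × Fin (d + 1) → ℝ) →ₗ[ℝ] (Tor (fine (L ^ i.m * L ^ i.k) (TGIndex.Mn d hL i)) × Fin (d + 1) → ℝ))
    (i : TGIndex) {B δ₀ γ₀ : ℝ} (hB : 0 ≤ B)
    (h : ∀ n : Fin 4, HasMaj (BlockNorm.ofBlocks (unitTorusGeo L i.k (TGIndex.Mn d hL i)) (blkFine L i.k (TGIndex.Mn d hL i)))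
      (BlockNorm.ofBlocks (unitTorusGeo L i.k (TGIndex.Mn d hL i))
        (fun j : Tor (fine (L ^ i.m * L ^ i.k) (TGIndex.Mn d hL i)) × Fin (d + 1) => blockOf (L ^ i.m * L ^ i.k) (TGIndex.Mn d hL i) j.1)) (tgOps d hL a T1 T2 i n ())
      (fun y y' => B * ((L : ℝ) ^ i.k) ^ (-γ₀) * Real.exp (-(δ₀ * tdistT (TGIndex.Mn d hL i) y y')))) :
    EtaRateIneq342 (tgFamily d hL a T1 T2 i) B δ₀ γ₀ () := by
  have hL0 : L ≠ 0 := NeZero.ne L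
  have hLr : (0 : ℝ) < (L : ℝ) := by exact_mod_cast Nat.pos_of_ne_zero hL0
  have hη : (unitTorusGeo L i.k (TGIndex.Mn d hL i)).eta ≠ 0 := inv_ne_zero (pow_ne_zero _ hLr.ne')
  show EtaRateIneq342 (opFamily (g := unitTorusGeo L i.k (TGIndex.Mn d hL i)) (B := pt9Bg) (blkFine L i.k (TGIndex.Mn d hL i))
    (fun j : Tor (fine (L ^ i.m * L ^ i.k) (TGIndex.Mn d hL i)) × Fin (d + 1) => blockOf (L ^ i.m * L ^ i.k) (TGIndex.Mn d hL i) j.1) (tgOps d hL a T1 T2 i)) B δ₀ γ₀ ()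
  refine etaRateIneq342_of_hasMaj (g := unitTorusGeo L i.k (TGIndex.Mn d hL i)) (B := pt9Bg) (blkFine L i.k (TGIndex.Mn d hL i))
    (fun j : Tor (fine (L ^ i.m * L ^ i.k) (TGIndex.Mn d hL i)) × Fin (d + 1) => blockOf (L ^ i.m * L ^ i.k) (TGIndex.Mn d hL i) j.1)
    (inv_nonneg.mpr (pow_nonneg hLr.le _)) hLr.le hB (tgOps d hL a T1 T2 i) () fun n => (h n).mono fun y y' => le_of_eq ?_
  have hp : B9.pref4 (1 : ℝ) n = 1 := by fin_cases n <;> simp [B9.pref4]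
  rw [opGeo_len, unitTorusGeo_len L i.k (TGIndex.Mn d hL i) hL0, hp, mul_one, rateFactor_opGeo _ _ _ hη hLr, rateFactor_opGeo _ _ _ hη hLr]
  show _ = B * Real.exp (-(δ₀ * tdistT (TGIndex.Mn d hL i) y y')) * max (((L : ℝ) ^ i.k) ^ (-γ₀)) (((L : ℝ) ^ i.k) ^ (-γ₀))
  rw [max_self]
  ring

/-- ★★ **NE2⁰, OPERATOR LAYER, FOR BAŁABAN's FULL LANDAU-GAUGE PAIR `(G′, G)` AT `U ≡ 1` — BY NAME, MODULO ENTRIES 1–2.**  For odd `L ≥ 3` and `a > 0`: if the consumer's entry-1∕2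
operators `T1 i`, `T2 i` (`𝔇(∇G)`, `𝔇(G∇*)` of the pair) have block majorants `B₁·(L^k)^{−γ₁}·e^{−δ₁|y−y′|_T}` with UNIFORM `B₁`, `γ₁ > 0`, `δ₁ > 0`, then the realised
paired-instance family of the torus family of record satisfies `T4EtaRate.NE2ZeroOperator` BY NAME — entries 0 and 3 are the theorems `hasMaj_twoGridDefect` (part 52) and
`hasMaj_twoGridDefect_lap` (part 54) at `γ = ½` (rate exponent `min(¼, γ₁)`, decay `min(min δ₀ δ₃, δ₁)`), nothing else is assumed.
[cite: Balaban1985BackgroundPropagators, Thm 3.1 (3.42) p.397 (shape); King1986, Props. 3.8–3.9 (3.71)–(3.75) pp.664–665 (A = 0 model)] -/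
theorem ne2ZeroOperator_fullG_of_entries12 (hLodd : Odd L) (hL2 : 2 ≤ L) (hL : Odd L ∧ 1 < L) {a : ℝ} (ha : 0 < a)
    (T1 T2 : ∀ i : TGIndex, (Tor (fine (L ^ i.k) (TGIndex.Mn d hL i)) × Fin (d + 1) → ℝ) →ₗ[ℝ] (Tor (fine (L ^ i.m * L ^ i.k) (TGIndex.Mn d hL i)) × Fin (d + 1) → ℝ))
    {B₁ γ₁ δ₁ : ℝ} (hγ₁ : 0 < γ₁) (hδ₁ : 0 < δ₁)
    (h1 : ∀ i : TGIndex, HasMaj (BlockNorm.ofBlocks (unitTorusGeo L i.k (TGIndex.Mn d hL i)) (blkFine L i.k (TGIndex.Mn d hL i)))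
      (BlockNorm.ofBlocks (unitTorusGeo L i.k (TGIndex.Mn d hL i))
        (fun j : Tor (fine (L ^ i.m * L ^ i.k) (TGIndex.Mn d hL i)) × Fin (d + 1) => blockOf (L ^ i.m * L ^ i.k) (TGIndex.Mn d hL i) j.1)) (T1 i)
      (fun y y' => B₁ * ((L : ℝ) ^ i.k) ^ (-γ₁) * Real.exp (-(δ₁ * tdistT (TGIndex.Mn d hL i) y y'))))
    (h2 : ∀ i : TGIndex, HasMaj (BlockNorm.ofBlocks (unitTorusGeo L i.k (TGIndex.Mn d hL i)) (blkFine L i.k (TGIndex.Mn d hL i)))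
      (BlockNorm.ofBlocks (unitTorusGeo L i.k (TGIndex.Mn d hL i))
        (fun j : Tor (fine (L ^ i.m * L ^ i.k) (TGIndex.Mn d hL i)) × Fin (d + 1) => blockOf (L ^ i.m * L ^ i.k) (TGIndex.Mn d hL i) j.1)) (T2 i)
      (fun y y' => B₁ * ((L : ℝ) ^ i.k) ^ (-γ₁) * Real.exp (-(δ₁ * tdistT (TGIndex.Mn d hL i) y y')))) :
    NE2ZeroOperator (tgInstance d hL) (tgFamily d hL a T1 T2) := by
  obtain ⟨δ₀, C₀, hδ₀, hC₀, H0⟩ := hasMaj_twoGridDefect (d := d) hLodd hL2 ha (γ := 1 / 2) (by norm_num) (by norm_num)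
  obtain ⟨δ₃, C₃, hδ₃, hC₃, H3⟩ := hasMaj_twoGridDefect_lap (d := d) hLodd hL2 ha (γ := 1 / 2) (by norm_num) (by norm_num)
  refine ⟨1, min (min δ₀ δ₃) δ₁, max (max C₀ C₃) B₁, min (1 / 4) γ₁, one_pos, lt_min (lt_min hδ₀ hδ₃) hδ₁, lt_max_of_lt_left (lt_max_of_lt_left hC₀),
    lt_min (by norm_num) hγ₁, fun i _ => ?_⟩
  have hLr : (1 : ℝ) ≤ (L : ℝ) := by exact_mod_cast (show 1 ≤ L by omega)
  have hx1 : (1 : ℝ) ≤ (L : ℝ) ^ i.k := one_le_pow₀ hLr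
  have hBmax : 0 ≤ max (max C₀ C₃) B₁ := hC₀.le.trans ((le_max_left _ _).trans (le_max_left _ _))
  have hrate : ∀ {e : ℝ}, min (1 / 4) γ₁ ≤ e → ((L : ℝ) ^ i.k) ^ (-e) ≤ ((L : ℝ) ^ i.k) ^ (-min (1 / 4) γ₁) := fun he =>
    Real.rpow_le_rpow_of_exponent_le hx1 (neg_le_neg he)
  have hexp : ∀ {δ : ℝ} (y y' : Tor (TGIndex.Mn d hL i)), min (min δ₀ δ₃) δ₁ ≤ δ →
      Real.exp (-(δ * tdistT (TGIndex.Mn d hL i) y y')) ≤ Real.exp (-(min (min δ₀ δ₃) δ₁ * tdistT (TGIndex.Mn d hL i) y y')) :=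
    fun y y' hδ => Real.exp_le_exp.mpr (neg_le_neg (mul_le_mul_of_nonneg_right hδ (tdistT_nonneg _ _ _)))
  have hmono : ∀ {B' e δ : ℝ}, B' ≤ max (max C₀ C₃) B₁ → min (1 / 4) γ₁ ≤ e → min (min δ₀ δ₃) δ₁ ≤ δ → ∀ y y' : Tor (TGIndex.Mn d hL i),
      B' * ((L : ℝ) ^ i.k) ^ (-e) * Real.exp (-(δ * tdistT (TGIndex.Mn d hL i) y y'))
        ≤ max (max C₀ C₃) B₁ * ((L : ℝ) ^ i.k) ^ (-min (1 / 4) γ₁) * Real.exp (-(min (min δ₀ δ₃) δ₁ * tdistT (TGIndex.Mn d hL i) y y')) := by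
    intro B' e δ hB' he hδ y y'
    by_cases hB'0 : 0 ≤ B'
    · exact mul_le_mul (mul_le_mul hB' (hrate he) (Real.rpow_nonneg (by positivity) _) hBmax) (hexp y y' hδ) (Real.exp_nonneg _)
        (mul_nonneg hBmax (Real.rpow_nonneg (by positivity) _))
    · exact (mul_nonpos_of_nonpos_of_nonneg (mul_nonpos_of_nonpos_of_nonneg (le_of_lt (not_le.mp hB'0)) (Real.rpow_nonneg (by positivity) _))
        (Real.exp_nonneg _)).trans (mul_nonneg (mul_nonneg hBmax (Real.rpow_nonneg (by positivity) _)) (Real.exp_nonneg _))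
  have hcast : ((L ^ i.k : ℕ) : ℝ) = (L : ℝ) ^ i.k := by push_cast; ring
  have hq : (-((1 : ℝ) / 2 / 2)) = -(1 / 4) := by norm_num
  have e0 := H0 i.mT i.k i.m i.one_le hL
  have e3 := H3 i.mT i.k i.m i.one_le hL
  refine etaRateIneq342_tg hL a T1 T2 i hBmax fun n => ?_
  fin_cases n
  · exact e0.mono fun y y' => by
      rw [hcast, hq]
      exact hmono ((le_max_left _ _).trans (le_max_left _ _)) (min_le_left _ _) ((min_le_left _ _).trans (min_le_left _ _)) y y'
  · exact (h1 i).mono fun y y' => hmono (le_max_right _ _) (min_le_right _ _) (min_le_right _ _) y y'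
  · exact (h2 i).mono fun y y' => hmono (le_max_right _ _) (min_le_right _ _) (min_le_right _ _) y y'
  · exact e3.mono fun y y' => by
      rw [hcast, hq]
      exact hmono ((le_max_right _ _).trans (le_max_left _ _)) (min_le_left _ _) ((min_le_left _ _).trans (min_le_right _ _)) y y'

/-- **NE2⁺, OPERATOR LAYER (the node's FIRST CONJUNCT `T4EtaRate.NE2PlusOperator` BY NAME) FOR THE PAIR `(G′, G)` — MODULO ENTRIES 1–2**, at the one-point background carrier (the
regularity condition (3.35) is VOID there: the «+» block is inert, the content is NE2⁰'s — said, as for part 17). [cite: Balaban1985BackgroundPropagators, Thm 3.1 p.397 (quantifier template)] -/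
theorem ne2PlusOperator_fullG_of_entries12 (hLodd : Odd L) (hL2 : 2 ≤ L) (hL : Odd L ∧ 1 < L) {a : ℝ} (ha : 0 < a) (c35 : ℝ)
    (T1 T2 : ∀ i : TGIndex, (Tor (fine (L ^ i.k) (TGIndex.Mn d hL i)) × Fin (d + 1) → ℝ) →ₗ[ℝ] (Tor (fine (L ^ i.m * L ^ i.k) (TGIndex.Mn d hL i)) × Fin (d + 1) → ℝ))
    {B₁ γ₁ δ₁ : ℝ} (hγ₁ : 0 < γ₁) (hδ₁ : 0 < δ₁)
    (h1 : ∀ i : TGIndex, HasMaj (BlockNorm.ofBlocks (unitTorusGeo L i.k (TGIndex.Mn d hL i)) (blkFine L i.k (TGIndex.Mn d hL i)))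
      (BlockNorm.ofBlocks (unitTorusGeo L i.k (TGIndex.Mn d hL i))
        (fun j : Tor (fine (L ^ i.m * L ^ i.k) (TGIndex.Mn d hL i)) × Fin (d + 1) => blockOf (L ^ i.m * L ^ i.k) (TGIndex.Mn d hL i) j.1)) (T1 i)
      (fun y y' => B₁ * ((L : ℝ) ^ i.k) ^ (-γ₁) * Real.exp (-(δ₁ * tdistT (TGIndex.Mn d hL i) y y'))))
    (h2 : ∀ i : TGIndex, HasMaj (BlockNorm.ofBlocks (unitTorusGeo L i.k (TGIndex.Mn d hL i)) (blkFine L i.k (TGIndex.Mn d hL i)))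
      (BlockNorm.ofBlocks (unitTorusGeo L i.k (TGIndex.Mn d hL i))
        (fun j : Tor (fine (L ^ i.m * L ^ i.k) (TGIndex.Mn d hL i)) × Fin (d + 1) => blockOf (L ^ i.m * L ^ i.k) (TGIndex.Mn d hL i) j.1)) (T2 i)
      (fun y y' => B₁ * ((L : ℝ) ^ i.k) ^ (-γ₁) * Real.exp (-(δ₁ * tdistT (TGIndex.Mn d hL i) y y')))) :
    NE2PlusOperator c35 (tgInstance d hL) (tgFamily d hL a T1 T2) := by
  obtain ⟨M₅, δ₀, B₀, γ₀, hM₅, hδ₀, hB₀, hγ₀, H⟩ := ne2ZeroOperator_fullG_of_entries12 (d := d) hLodd hL2 hL ha T1 T2 hγ₁ hδ₁ h1 h2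
  exact ⟨M₅, δ₀, 1, B₀, γ₀, hM₅, hδ₀, one_pos, hB₀, hγ₀, fun i hM _ _ _ U _ => by cases U; exact H i hM⟩

end Summit.QuantumFields.YangMills.BalabanUVNodes.N15.TwoGrid
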